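import Summits.QuantumFields.YangMills.Theses.XiCompleteMonotonicity
import Summits.QuantumFields.YangMills.Theorems.XiCompleteMonotonicityAsymptoticFreedomBound
import HarnessLib

/-!
# Route `XiCompleteMonotonicity` (YangMills): the support item `AsymptoticFreedomBound` (stmt-QuantumFields-8944) holds BY NAME

`AsymptoticFreedomBound := XiExpLowerBound → ∀ G … r sch Δ, 0 < Δ → HasLatticeMassGap r sch Δ → Tendsto sch.β atTop atTop →
∃ c K, 0 < c ∧ ∀ᶠ k, Δ · a_k ≤ K β_k e^{-c β_k}` — every Wilson-lattice scheme with a volume-uniform lattice mass gap `Δ` in physical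
units and `β_k → ∞` must shrink its spacing at least exponentially in the bare inverse coupling, CONDITIONAL on the route's target
`XiExpLowerBound`.  The implication was proved hypothesis-explicit by seat ym-idea-4 g7 as
`S28AsymptoticFreedomBound.asymptoticFreedomBound_of_xiExpLowerBound` (module `XiCompleteMonotonicityAsymptoticFreedomBound`, landed
2026-08-28 while this route file did not build, hence typed by the RECORD `Theorems.Theses.XiCompleteMonotonicity.XiExpLowerBound` of
module `XiCompleteMonotonicityRecords`, byte-equal to the route body).  The route file builds again, so this module states the item by
its route decl and closes it with that theorem (the record hypothesis and the route's `XiExpLowerBound` are the same proposition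
by `rfl`).  Mechanism of the landed proof: along the odd tori a torus-limit state exists (Prokhorov), the torus connected plaquette
correlator is `latticeConnectedCorr` and converges to `f_{β_k,μ}(n e₀)`, so the volume-uniform gap bound `C e^{-Δ a_k n}` passes to
the limit and is squeezed against `XiExpLowerBound`'s `A e^{-m n}`, forcing `Δ a_k ≤ m ≤ K β_k e^{-c β_k}`.

HONEST FRAMING: bookkeeping (a by-name bridge, width seat ym-line-sfw-p2-w3 g35, free hands); `XiExpLowerBound` (the route's target)
and the crux `ExponentialWindow` are NOT proved; no summit conjunct is touched; the Yang–Mills mass gap is NOT proved.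
References: [cite: JaffeWitten2000, §§1, 5]; [cite: MontvayMunster1994, §3.4].
-/

set_option autoImplicit false

namespace Summit.QuantumFields.YangMills.Theorems

/-- **`AsymptoticFreedomBound` holds** (item stmt-QuantumFields-8944 of route `XiCompleteMonotonicity`, BY NAME): conditional on
`XiExpLowerBound`, every Wilson-lattice scheme `sch` of a compact simple Lie `G` with a volume-uniform lattice mass gap `Δ > 0`
(`HasLatticeMassGap r sch Δ`) and `β_k → ∞` satisfies `Δ a_k ≤ K β_k e^{-c β_k}` eventually, for some `c > 0`, `K` — the instance of
`S28AsymptoticFreedomBound.asymptoticFreedomBound_of_xiExpLowerBound` (its record hypothesis is the route's `XiExpLowerBound` verbatim).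
No summit conjunct is touched; the Yang–Mills mass gap is NOT proved. [cite: JaffeWitten2000, §5] [cite: MontvayMunster1994, §3.4] -/
theorem xiCompleteMonotonicity_asymptoticFreedomBound_proof :
    Summit.QuantumFields.YangMills.Theses.XiCompleteMonotonicity.AsymptoticFreedomBound :=
  fun hX => S28AsymptoticFreedomBound.asymptoticFreedomBound_of_xiExpLowerBound hX

end Summit.QuantumFields.YangMills.Theorems
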